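import Literature.NumberTheory.PAdicHodge.AinfRamifiedWittTwistedTheta
import HarnessLib

/-!
# Roots of the Frobenius-conjugate Eisenstein polynomials: `‖ρ‖ = ‖π‖`

Topic `Literature/NumberTheory/PAdicHodge`; THEOREMS only (solo-Langlands-informed Stage E2.10a). For a `W(k_F)`-Eisenstein
datum `D` of a finite `F/ℚ_p` (tree `EisensteinRootW`: `D.poly = X^e + c_{e-1}X^{e-1} + ⋯ + c₀ ∈ W(k_F)[X]`, `p ∣ cᵢ`,
`c₀ = p·unit`, `D.poly(π) = 0` with `π = D.unif`) and the `φ^j`-twisted coefficient map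
`twistCoeff hp j = θ ∘ φ^j : W(k_F) → 𝒪_{ℂ_F}` (tree `AinfRamifiedWittTwistedTheta`), every root `ρ ∈ 𝒪_{ℂ_F}` of the
conjugate polynomial `D.poly^{(φ^j)}` satisfies the Eisenstein estimates:

* `pow_deg_eq_of_eval₂_twistCoeff : ρ^e = −Σ_{i<e} φ^j(cᵢ) ρ^i`; `norm_twistCoeff_coeff_le : ‖φ^j(cᵢ)‖ ≤ ‖p‖`,
  `norm_twistCoeff_coeff_zero : ‖φ^j(c₀)‖ = ‖p‖` (`norm_coe_units_integerC : ‖u‖ = 1` for units of `𝒪_{ℂ_F}`);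
* `norm_lt_one_of_eval₂_twistCoeff : ‖ρ‖ < 1`, `norm_pow_deg_of_eval₂_twistCoeff : ‖ρ‖^e = ‖p‖`, and
  ★ `norm_eq_norm_unif_of_eval₂_twistCoeff : ‖ρ‖ = ‖π‖` — the hypothesis `hρπ` of the eigenvector theorem
  `exists_eigenvector_of_thetaTwist` (tree `LubinTateWittTwistEigenvector`).

## References
* J.-P. Serre, *Local Fields* (1979), Ch. I §6 Prop. 17, Ch. II §5. [SerreLocalFields1979]
* J. W. S. Cassels, A. Fröhlich (eds.), *Algebraic Number Theory* (1967), Ch. I §6 Thm. 1. [CasselsFrohlichANT1967]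
-/

noncomputable section

open IsLocalRing WittVector

namespace Literature.NumberTheory.PAdicHodge

open Literature.NumberTheory.GaloisRepresentations
open Literature.NumberTheory.GaloisRepresentations.IsNonarchimedeanLocalField
open Field ValuativeRel

variable {F : Type} [Field F] [ValuativeRel F] [TopologicalSpace F] [IsNonarchimedeanLocalField F] [CharZero F]
  {p : ℕ} [Fact p.Prime] {hp : valuation F p < 1}

omit [CharZero F] [Fact p.Prime] in
/-- Units of `𝒪_{ℂ_F}` have absolute value `1`. [cite: SerreLocalFields1979, Ch. II §5] -/
theorem norm_coe_units_integerC (u : (integerC F)ˣ) : ‖((u : integerC F) : CompletedAlgClosure F)‖ = 1 := by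
  have h1 : ‖((u : integerC F) : CompletedAlgClosure F)‖ ≤ 1 := norm_coe_integerC_le _
  have h2 : ‖(((u⁻¹ : (integerC F)ˣ) : integerC F) : CompletedAlgClosure F)‖ ≤ 1 := norm_coe_integerC_le _
  have h3 : ‖((u : integerC F) : CompletedAlgClosure F)‖ * ‖(((u⁻¹ : (integerC F)ˣ) : integerC F) : CompletedAlgClosure F)‖ = 1 := by
    rw [← norm_mul, ← MulMemClass.coe_mul, Units.mul_inv, OneMemClass.coe_one, norm_one]
  by_contra hne
  have hlt : ‖((u : integerC F) : CompletedAlgClosure F)‖ < 1 := lt_of_le_of_ne h1 hne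
  have : ‖((u : integerC F) : CompletedAlgClosure F)‖ *
      ‖(((u⁻¹ : (integerC F)ˣ) : integerC F) : CompletedAlgClosure F)‖ < 1 := by
    calc _ ≤ ‖((u : integerC F) : CompletedAlgClosure F)‖ * 1 := mul_le_mul_of_nonneg_left h2 (norm_nonneg _)
      _ < 1 := by rw [mul_one]; exact hlt
  exact absurd h3 this.ne

namespace EisensteinRootW

variable [Fact (¬ IsUnit (p : integerC F))] [IsAdicComplete (Ideal.span {(p : integerC F)}) (integerC F)]
  (D : EisensteinRootW F p hp) (j : ℕ)

/-- `‖φ^j(cᵢ)‖ ≤ ‖p‖` for the non-leading coefficients (`p ∣ cᵢ`). [cite: SerreLocalFields1979, Ch. I §6 Prop. 17] -/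
theorem norm_twistCoeff_coeff_le {i : ℕ} (hi : i < D.deg) :
    ‖((twistCoeff hp j (D.poly.coeff i) : integerC F) : CompletedAlgClosure F)‖ ≤ ‖(p : CompletedAlgClosure F)‖ := by
  obtain ⟨c, hc⟩ := D.dvd_coeff hi
  rw [hc, map_mul, map_natCast, MulMemClass.coe_mul, SubringClass.coe_natCast, norm_mul]
  exact mul_le_of_le_one_right (norm_nonneg _) (norm_coe_integerC_le _)

set_option maxHeartbeats 400000 in
/-- `‖φ^j(c₀)‖ = ‖p‖` (`c₀ = p·unit`). [cite: SerreLocalFields1979, Ch. I §6 Prop. 17] -/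
theorem norm_twistCoeff_coeff_zero :
    ‖((twistCoeff hp j (D.poly.coeff 0) : integerC F) : CompletedAlgClosure F)‖ = ‖(p : CompletedAlgClosure F)‖ := by
  obtain ⟨u, hu⟩ := D.exists_coeff_zero_eq_mul_unit
  have h : twistCoeff hp j (u : wittFixed F p) = ((Units.map (twistCoeff hp j : wittFixed F p →* integerC F) u :
      (integerC F)ˣ) : integerC F) := by
    rw [Units.coe_map, MonoidHom.coe_coe]
  rw [hu, map_mul, map_natCast, MulMemClass.coe_mul, SubringClass.coe_natCast, norm_mul, h, norm_coe_units_integerC,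
    mul_one]

variable {ρ : integerC F} (hρ : D.poly.eval₂ (twistCoeff hp j) ρ = 0)

include hρ in
set_option maxHeartbeats 800000 in
/-- `ρ^e = −(φ^j(c₀) + φ^j(c₁)ρ + ⋯ + φ^j(c_{e−1})ρ^{e−1})` in `ℂ_F` for a root `ρ` of the `φ^j`-conjugate Eisenstein
polynomial. [cite: SerreLocalFields1979, Ch. I §6 Prop. 17] -/
theorem pow_deg_eq_of_eval₂_twistCoeff :
    (ρ : CompletedAlgClosure F) ^ D.deg =
      - ∑ i ∈ Finset.range D.deg, ((twistCoeff hp j (D.poly.coeff i) : integerC F) : CompletedAlgClosure F) *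
        (ρ : CompletedAlgClosure F) ^ i := by
  have h0 : (integerC F).subtype (D.poly.eval₂ (twistCoeff hp j) ρ) = 0 := by rw [hρ, map_zero]
  rw [Polynomial.hom_eval₂, Polynomial.eval₂_eq_sum_range, Finset.sum_range_succ] at h0
  have hlead : D.poly.coeff D.poly.natDegree = 1 := D.monic
  rw [hlead, map_one, one_mul] at h0
  rw [deg_def, eq_neg_iff_add_eq_zero, add_comm]
  exact h0

include hρ in
set_option maxHeartbeats 800000 in
/-- **`‖ρ‖ < 1`** for every root of the conjugate Eisenstein polynomial. [cite: SerreLocalFields1979, Ch. I §6 Prop. 17] -/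
theorem norm_lt_one_of_eval₂_twistCoeff : ‖(ρ : CompletedAlgClosure F)‖ < 1 := by
  by_contra hge
  rw [not_lt] at hge
  have hp1 : ‖(p : CompletedAlgClosure F)‖ < 1 := norm_natCast_C_lt_one hp
  have he := D.deg_pos
  have hbound : ‖(ρ : CompletedAlgClosure F) ^ D.deg‖ ≤ ‖(p : CompletedAlgClosure F)‖ * ‖(ρ : CompletedAlgClosure F)‖ ^ (D.deg - 1) := by
    rw [D.pow_deg_eq_of_eval₂_twistCoeff j hρ, norm_neg]
    refine IsUltrametricDist.norm_sum_le_of_forall_le_of_nonneg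
      (mul_nonneg (norm_nonneg _) (pow_nonneg (norm_nonneg _) _)) fun i hi => ?_
    rw [Finset.mem_range] at hi
    rw [norm_mul, norm_pow]
    refine mul_le_mul (D.norm_twistCoeff_coeff_le j hi) ?_ (pow_nonneg (norm_nonneg _) _) (norm_nonneg _)
    exact pow_le_pow_right₀ hge (by omega)
  have hlt : ‖(p : CompletedAlgClosure F)‖ * ‖(ρ : CompletedAlgClosure F)‖ ^ (D.deg - 1) <
      ‖(ρ : CompletedAlgClosure F)‖ ^ D.deg := by
    calc ‖(p : CompletedAlgClosure F)‖ * ‖(ρ : CompletedAlgClosure F)‖ ^ (D.deg - 1) <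
          1 * ‖(ρ : CompletedAlgClosure F)‖ ^ (D.deg - 1) :=
          mul_lt_mul_of_pos_right hp1 (pow_pos (lt_of_lt_of_le one_pos hge) _)
      _ ≤ ‖(ρ : CompletedAlgClosure F)‖ ^ D.deg := by
        rw [one_mul]
        exact pow_le_pow_right₀ hge (Nat.sub_le _ _)
  rw [norm_pow] at hbound
  exact absurd (hbound.trans_lt hlt) (lt_irrefl _)

include hρ in
set_option maxHeartbeats 800000 in
/-- **`‖ρ‖^e = ‖p‖`** (the constant term `φ^j(c₀) = p·unit` dominates). [cite: SerreLocalFields1979, Ch. I §6 Prop. 17] -/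
theorem norm_pow_deg_of_eval₂_twistCoeff : ‖(ρ : CompletedAlgClosure F)‖ ^ D.deg = ‖(p : CompletedAlgClosure F)‖ := by
  have hx1 := D.norm_lt_one_of_eval₂_twistCoeff j hρ
  have hc0 := D.norm_twistCoeff_coeff_zero j
  have hp0 : 0 < ‖(p : CompletedAlgClosure F)‖ := norm_pos_iff.2 (natCast_C_ne_zero (Fact.out : p.Prime).ne_zero)
  have hsplit : (ρ : CompletedAlgClosure F) ^ D.deg =
      -(((twistCoeff hp j (D.poly.coeff 0) : integerC F) : CompletedAlgClosure F) +
        ∑ i ∈ Finset.Ico 1 D.deg, ((twistCoeff hp j (D.poly.coeff i) : integerC F) : CompletedAlgClosure F) *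
          (ρ : CompletedAlgClosure F) ^ i) := by
    rw [D.pow_deg_eq_of_eval₂_twistCoeff j hρ, Finset.range_eq_Ico, Finset.sum_eq_sum_Ico_succ_bot D.deg_pos, pow_zero,
      mul_one]
  have htail : ‖∑ i ∈ Finset.Ico 1 D.deg, ((twistCoeff hp j (D.poly.coeff i) : integerC F) : CompletedAlgClosure F) *
      (ρ : CompletedAlgClosure F) ^ i‖ < ‖(p : CompletedAlgClosure F)‖ := by
    refine lt_of_le_of_lt (IsUltrametricDist.norm_sum_le_of_forall_le_of_nonneg
      (C := ‖(p : CompletedAlgClosure F)‖ * ‖(ρ : CompletedAlgClosure F)‖)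
      (mul_nonneg (norm_nonneg _) (norm_nonneg _)) fun i hi => ?_) ?_
    · rw [Finset.mem_Ico] at hi
      rw [norm_mul, norm_pow]
      refine mul_le_mul (D.norm_twistCoeff_coeff_le j hi.2) ?_ (pow_nonneg (norm_nonneg _) _) (norm_nonneg _)
      calc ‖(ρ : CompletedAlgClosure F)‖ ^ i ≤ ‖(ρ : CompletedAlgClosure F)‖ ^ 1 :=
            pow_le_pow_of_le_one (norm_nonneg _) hx1.le hi.1
        _ = _ := pow_one _
    · calc ‖(p : CompletedAlgClosure F)‖ * ‖(ρ : CompletedAlgClosure F)‖ < ‖(p : CompletedAlgClosure F)‖ * 1 :=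
            mul_lt_mul_of_pos_left hx1 hp0
        _ = _ := mul_one _
  rw [← norm_pow, hsplit, norm_neg]
  rw [← hc0] at htail ⊢
  exact IsUltrametricDist.norm_add_eq_max_of_norm_ne_norm (ne_of_gt htail) |>.trans (max_eq_left htail.le)

include hρ in
/-- ★ **All roots of the conjugate Eisenstein polynomials have absolute value `‖ρ‖ = ‖π‖ = ‖p‖^{1/e}`** — the
hypothesis `hρπ` of `exists_eigenvector_of_thetaTwist`. [cite: CasselsFrohlichANT1967, Ch. I §6 Thm. 1] -/
theorem norm_eq_norm_unif_of_eval₂_twistCoeff :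
    ‖(ρ : CompletedAlgClosure F)‖ = ‖algebraMap F (CompletedAlgClosure F) D.unif‖ :=
  (pow_left_inj₀ (norm_nonneg _) (norm_nonneg _) D.deg_pos.ne').1
    ((D.norm_pow_deg_of_eval₂_twistCoeff j hρ).trans D.norm_algebraMap_unif_pow.symm)

end EisensteinRootW

end Literature.NumberTheory.PAdicHodge

end
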